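import Summits.CriticalPhenomena.CardyFormulaZ2.Theorems.CardySelfDualSegmentUniformMarginalityStubFixedDomainContinuityOne

/-!
# Skeleton v10 of line `Sketch` (idea `pivotal-balance-heat-flow`) for the crux `UniformMarginality`
(stmt-CriticalPhenomena-5472, route `CardySelfDualSegment`) — lead prover-line-stmt-CriticalPhenomena-5472-c6-0 / header v10.3 by -c11-0
(continuation 6; earlier leads prover-line-stmt-CriticalPhenomena-5472-0, -c1-0, -c2-0, -c3-0, -c4-0, -c5-0)

v10.3 (lead c11, prover-line-stmt-CriticalPhenomena-5472-c11-0, 2026-08-17; STUBS UNCHANGED): the t-UNIFORMITY of the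
route's two research cruxes is now ONE tree theorem.  Landed `--supports` this seat:
`…UniformMarginalityPointwiseBoxCrossing` (p157143: `uniformBoxCrossing_of_marginalityAt_of_pointwise` —
marginality at the ONE tall rectangle `Q₀ = rectQuad 0 1 0 4` + `HasBoxCrossingProperty (cornerPercolation t)` for
every single `t` ⟹ `NonSlantStatement` ⟹ `UniformBoxCrossing`, by compactness of `[0,1]` through the sandwiches
`stub_crudeLeNonSlant` p155901 / `stub_boxBoundsLeCrude` p156283 and the 5476 engine; corollaries
`uniformBoxCrossing_of_uniformMarginalityRect_of_pointwise`, `…_of_uniformMarginality_of_pointwise`,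
`uniformBoxCrossing_iff_pointwise_of_uniformMarginalityRect`, `cardyFormulaZ2_of_rectilinearCruxes_pointwise` :
SegmentOpen_rect → UM_rect → (∀ t, HasBoxCrossingProperty (M_t)) → CardyFormulaZ2) and
`…UniformMarginalityTargetGivesPointwise` (p157891: `hasBoxCrossingProperty_of_target` — the route's `Target`
forces POINTWISE box crossing of every `M_t` (Cardy values in `(0,1)`, sandwich `stub_crudeLeLrCrossing` p157455,
pointwise render `stub_pointwiseRender` p157644); hence `uniformBoxCrossing_of_target_of_uniformMarginality :
Target → UniformMarginality → UniformBoxCrossing` — crux 5476 is NECESSARY for the target given marginality —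
and `uniformBoxCrossing_of_integratedBoundRectilinear_of_target : (B₁) → Target → UniformBoxCrossing`).
Reading: after the certified split the planner may restate stmt-5476 POINTWISE (one B–R-Conj.-8.2 instance per
`t`); all t-uniformity of the route lives in (B₁) = UM_rect.  (B₁), (B₂ᵒ) themselves unchanged (research).

v10.2 (lead c6, 2026-08-17; STUBS UNCHANGED from v10/v10.1): state of the tree re-checked by this seat — c4's mirror
census is LANDED (`…MirrorCensus`, p143330: `hasDerivAt_Pext_mirrorCensus`, `deriv_Pext_eq_mirrorCensus_verts`,
`integratedBoundAt_of_mirrorDomination`) and so is c5's exact corner-parity (Walsh) expansion (`…Walsh`, p145353: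
`Pext_eq_sum_walsh_bond`, `P_t(R,δ) = Σ_V (1−t)^{|V|} a_V`).  Both registered stubs remain research kernels behind
Russo–Seymour–Welsh bounds for the corner model `M_t` (crux `UniformBoxCrossing`, stmt-CriticalPhenomena-5476, open;
its own line is down to one stub `stub_endpointDomination`): (B₂ᵒ) needs them pointwise in `t₀` plus a port of the
tree's Schramm–Smirnov (5.1) chain (`QuadCrossing*`, hard-wired to `bondPercolation` / `squareCrossingLaw`) to a general
lattice law; (B₁) needs them uniformly in `t` plus the sharp spare-arm domination SAD.  No worker-provable stub ⇒
wave: none.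

v10.1 (lead c4): landed the split glue `Split.UniformMarginality_of_subs` (p141446: the strategist's certified 3-way
split, children verbatim, child 3 PROVED), the corner mirror `Ŝ_v` (`…MirrorDefs`, p141947), the integrated Russo
integrand (`…MirrorIntegrand`, p142358), the mirror pairing (`…MirrorPivotal`, p142893) and the census as an exact
mirror antisymmetrisation (`…MirrorCensus`, p143330):
  ∂_t P_t(R,δ) = ¼ Σ_{v ∈ verts R δ} [Π_v^t(A) − Π_v^t(A^{Ŝ_v})],  Π_v^t(B) = M_t{N_v pivotal for B in ω ∖ {E_v}},
A = crossEvent R δ — the lattice identity "λ⁺ = λ⁻" at every mesh; (B₁) at a rectilinear R is thereby reduced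
(`integratedBoundAt_of_mirrorDomination`) to TERMWISE domination of the mirror-odd response by a summable
majorant family (spare-arm domination SAD + UniformBoxCrossing stmt-5476: research).

v10 = v9 with the endpoint stub (N) `stub_fixedDomainContinuity_one` LANDED (`…StubFixedDomainContinuityOne.lean`:
Schramm–Smirnov Lemma 5.1 discharged in the tree + the Freeze bridge + `cornerPercolation_one`; sub-stubs N1–N3
landed) and the open-interval transport kernel (B₂ᵒ) RESTATED IN ITS CANONICAL FORM: Schramm–Smirnov's discrete
continuity estimate (5.1) for the SINGLE model `M_{t₀} = cornerPercolation t₀`, `0 < t₀ < 1`, at every quad of the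
plane (`stub_discreteContinuity_interior`).  The landed general-law bridge `fixedDomainContinuityAt_of_discrete`
(`…CrudeContinuityFor.lean`: the Freeze bridge and the endpoint assembly re-run for an arbitrary law carried by lattice
configurations) turns it into the v6 kernel (B₂a″) at `t₀`; both endpoints of that kernel are landed (`t₀ = 0`:
`fixedDomainContinuity_zero`, p116559, Smirnov + Radó; `t₀ = 1`: `stub_fixedDomainContinuity_one`, p140668).

THE LINE (vocabulary `Theorems/CardySelfDualSegmentUniformMarginalityDefs.lean`, p96304; namespace
`…Cruxes.UniformMarginality.HeatFlow`; `Pext R δ t = cornerCrossingProb t R δ`):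
* (B₁) `stub_integratedBoundRectilinear` — THE CRUX ON TAME (rectilinear) DOMAINS: `t ↦ P_t(R,δ)` has at every
  `t₀ ∈ [0,1]` a modulus of continuity uniform in the mesh. Research kernel = quantitative marginality proper
  (exact Russo identities (R)/(R_E)/(HF)/(PB), large-mesh half, MVT glue landed; missing: t-uniform RSW for `M_t` =
  crux `UniformBoxCrossing` stmt-CriticalPhenomena-5476 AND the pointwise five-arm domination C⁺ at the sharp rate
  3/4; numerically alive, kit j015475/j015527/j019239).
* (B₂ᵒ) `stub_discreteContinuity_interior` — SCHRAMM–SMIRNOV (5.1) FOR `M_{t₀}`, `0 < t₀ < 1`: for every quad `Q₀`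
  of the plane and `ε > 0` there are quads `Q' < Q₀ < Q''` (Schramm–Smirnov's strict order) and `δ₀ > 0` with
  `M_{t₀}[Q' crossed inside the open edges of δℤ² ∧ Q'' not crossed] ≤ ε` for `0 < δ < δ₀`.  For `t₀ = 1` this is
  the tree's theorem `Quad.continuity_of_lemma_5_1 SchrammSmirnov2011_lemma_5_1_holds` (critical bond-ℤ²); for
  `0 < t₀ < 1` it is research: it needs RSW for `M_{t₀}` (⟸ stmt-5476, open even pointwise: B–R 2010 Conj. 8.2
  class) and a re-run for the corner model of the ONE primal chart-move bound of SS Lemma 6.1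
  (`QuadLowestCrossingProofs` Parts I–III, 2261 lines for bond-ℤ²: lowest crossing of the explored region, thin place,
  closed dual arm off the revealed edges, decoupling + RSW) with a CORNER-WISE exploration (reveal partner edges, so
  that the unrevealed configuration stays a product over corners); the other three moves are chart reflections
  (`chartCrossed_negRe_trans_iff`, measure-free) and self-duality up to the π-rotation
  (`cornerPercolation_real_preimage_dualConfig`).
  Orthogonal to marginality; disappears if the route quantifies the crux over rectilinear conformal rectangles
  (restated route landed, p137735/p137925).
Composition: the landed reduction `uniformMarginality_of_rectilinear_of_discreteInterior` ((B₂ᵒ) ⟹ (B₂a″) on (0,1)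
by the general-law bridge; case glue `fixedDomainContinuity_of_cases` with the two landed endpoints; then the landed v6
chain `stub_uniformSandwichOfFixedDomainContinuity` (p116281) → `stub_transportOfUniformSandwich` (p111792) →
`uniformMarginality_of_integratedBound` (p96304)); `UniformMarginality_of` concludes
`CardySelfDualSegment.UniformMarginality` BY NAME.
-/

noncomputable section

namespace Summit.CriticalPhenomena.CardyFormulaZ2.Cruxes.UniformMarginality.HeatFlow

open scoped ENNReal
open Literature.Probability.Percolation Literature.Probability.LatticeModels
  Literature.Probability.RandomPlanarGeometry
open Literature.Probability.Percolation.QuadCrossing (Quad)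
open Literature.Probability.Percolation.QuadCrossing.Quad (StrictlyDominated)

/-- STUB (B₁): **the crux on rectilinear conformal rectangles** — for `R` whose boundary is covered by
finitely many axis-parallel segments the map `t ↦ P_t(R,δ)` has, at every `t₀ ∈ [0,1]`, a modulus of
continuity uniform in the mesh. Intended proof: the landed exact mirror census
`deriv_Pext_eq_mirrorCensus_verts` (∂_t P_t = ¼ Σ_v [Π_v(A) − Π_v(A^{Ŝ_v})]) + termwise spare-arm domination
(SAD) + summability of the spare-arm pivotal events (UniformBoxCrossing stmt-5476 + universal exponents), via the
landed `integratedBoundAt_of_mirrorDomination`. Research (needs stmt-CriticalPhenomena-5476 + SAD). -/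
theorem stub_integratedBoundRectilinear :
    ∀ R : ConformalRectangle,
      (∃ S : Finset (ℂ × ℂ), (∀ p ∈ S, p.1.re = p.2.re ∨ p.1.im = p.2.im) ∧
        frontier R.carrier ⊆ ⋃ p ∈ S, segment ℝ p.1 p.2) →
      ∀ t₀ : ℝ, t₀ ∈ Set.Icc (0 : ℝ) 1 → ∀ ε > 0, ∃ η > 0,
        ∀ δ : ℝ, 0 < δ → ∀ t ∈ Set.Icc (0 : ℝ) 1, |t - t₀| < η → |Pext R δ t - Pext R δ t₀| < ε := by
  sorry

/-- STUB (B₂ᵒ): **Schramm–Smirnov's discrete continuity estimate (5.1) for the single corner model `M_{t₀}`,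
`0 < t₀ < 1`** — for every quad `Q₀` of the plane and `ε > 0` there are quads `Q' < Q₀ < Q''` and `δ₀ > 0` such
that `M_{t₀}[Q' crossed inside the open edges of δℤ² ∧ Q'' not crossed] ≤ ε` for all `0 < δ < δ₀`.  (At `t₀ = 1`
this is the tree's `Quad.continuity_of_lemma_5_1 SchrammSmirnov2011_lemma_5_1_holds`; research for
`0 < t₀ < 1`: RSW for `M_{t₀}` + the primal chart-move bound of SS Lemma 6.1 for the corner model with a
corner-wise exploration.) -/
theorem stub_discreteContinuity_interior :
    ∀ t₀ : unitInterval, 0 < (t₀ : ℝ) → (t₀ : ℝ) < 1 →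
      ∀ (Q₀ : Quad (Set.univ : Set ℂ)) (ε : ℝ≥0∞), 0 < ε →
        ∃ Q' Q'' : Quad (Set.univ : Set ℂ), StrictlyDominated Q' Q₀ ∧ StrictlyDominated Q₀ Q'' ∧
          ∃ δ₀ : ℝ, 0 < δ₀ ∧ ∀ δ : ℝ, 0 < δ → δ < δ₀ →
            cornerPercolation t₀ {ω | (∃ K, Q'.IsCrossing K ∧ K ⊆ openEdgeUnion δ ω) ∧
                ¬ ∃ K, Q''.IsCrossing K ∧ K ⊆ openEdgeUnion δ ω} ≤ ε := by
  sorry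

/-- **The line closes the crux modulo its two research kernels**: the landed v10 reduction
`uniformMarginality_of_rectilinear_of_discreteInterior` (`…StubFixedDomainContinuityOne.lean`: general-law bridge
`fixedDomainContinuityAt_of_discrete` p140602, endpoint kernels `fixedDomainContinuity_zero` p116559 /
`fixedDomainContinuity_one` p140668, case glue `fixedDomainContinuity_of_cases`, v6 glue p116281, transport p111792,
MVT glue p96304) applied to (B₁) and (B₂ᵒ) concludes `CardySelfDualSegment.UniformMarginality` by name. -/
theorem UniformMarginality_of :
    Summit.CriticalPhenomena.CardyFormulaZ2.Theses.CardySelfDualSegment.UniformMarginality :=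
  uniformMarginality_of_rectilinear_of_discreteInterior stub_integratedBoundRectilinear stub_discreteContinuity_interior

end Summit.CriticalPhenomena.CardyFormulaZ2.Cruxes.UniformMarginality.HeatFlow

end
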